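import Summits.KontsevichZagierPeriods.Statement
import Literature.NumberTheory.Transcendental.KZCalculusProofs
import Literature.NumberTheory.Transcendental.KZVolumeConjectureProofs
import Literature.NumberTheory.Transcendental.KZKernelConjectureForms
import Literature.NumberTheory.Transcendental.KZUnfolding
import Literature.NumberTheory.Transcendental.KZRelationsLE
import Literature.NumberTheory.Transcendental.KZSubcalculusInvariants
import Literature.NumberTheory.Transcendental.KZLogCalculusProofs

/-!
# Disproof of `VolumeFormOffPlane` (stmt-KontsevichZagierPeriods-14935) — findings: NO KILL; the crux is the summit

Standing disprover's work file (refuter `cdisprove`, cycle 1, 2026-08-16) for the crux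
`VolumeFormOffPlane` of route `SymplecticScissors`:

  `∀ ⦃N⦄, N ≠ 2 → ∀ r r' : KZ.IntegralRep N, (integrand r = 1 on its domain) →
     (integrand r' = 1 on its domain) → r.value = r'.value → KZ.Equivalent r r'`.

ROUTE-FILE-FREE: the route module `Theses/SymplecticScissors.lean` was farm-incoherent for the whole
cycle, so this file MIRRORS the three decls it attacks (`VolumeFormOffPlane`, `VolumeForm`,
`PlanarAreas`, verbatim bodies, identification `Iff.rfl`) instead of importing them — see the
"Local mirrors" section. INDEX (prose only in docstrings; everything below is kernel-checked, no `sorry`):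

* §0 `VolumeFormAt N` — the frame sliced by dimension; the crux is `∀ N ≠ 2, VolumeFormAt N`
  (`Iff.rfl`), the frame `VolumeForm` is `∀ N, VolumeFormAt N`, the layer `PlanarAreas` is
  `VolumeFormAt 2`.
* §1 STRENGTH (why no cheap kill exists). The slab ladder `VolumeFormAt (N+1) → VolumeFormAt N`
  (one Newton–Leibniz move `[A × [0,1]] − [A]`, tree lemma `KZ.IntegralRep.equivalent_slab`), hence
  `VolumeFormOffPlane ↔ (∀ N ≥ 3, VolumeFormAt N) ↔ VolumeForm ↔ KontsevichZagierPeriods`: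
  the hypothesis `N ≠ 2` is DECORATIVE, the crux already carries the plane and the line, and any
  refutation of it is a refutation of the summit as formalised. Failing dimensions form an UP-SET.
* §2 LOAD-BEARING ANALYSIS. `value_eq` is load-bearing (`volumeFormOffPlane_false_without_valueEq`,
  witnesses in dimension 0 AND dimension 3); `integrand = 1` is NOT (dropping it gives a statement
  equivalent to the summit again: `withoutIntegrandOne_iff_summit`); `N ≠ 2` is not (§1).
* §3 DEGENERATE INSTANCES HOLD (no mis-typing to exploit): null domains are `0` modulo moves,
  off-domain integrand values are invisible (identity move), value `0` forces a null domain, and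
  the whole slice `N = 0` is a theorem (`volumeFormAt_zero`).
* §4 REFUTED NATURAL STRENGTHENING: ONE move never suffices — `[0,1]³` vs `(0,1)³` (and `[0,1]` vs
  `(0,1)`) are not related by a single instance of any of the four rules (`not_volumeFormOffPlaneOneMove`):
  cuts (rule 1a) are load-bearing in every dimension of the crux.
* §4b NATURAL WEAKENING NOT WEAKER: "up to torsion" ↔ the crux (`FormalRep ⧸ relations` is
  torsion-free, tree lemma `mem_relations_of_nsmul_mem_relations`).
* §5 DEHN FORM: `¬ VolumeFormOffPlane` is EXACTLY the existence of an additive invariant of formal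
  combinations, vanishing on the four move sets, that separates two equal-volume ℚ-semialgebraic
  solids of some dimension `N ≥ 3` — the only shape a disproof can take.
* §6 Targets / line notes (comments): the lead's PICKED line `log-polytope-hilbert-three`; no
  skeleton registered yet, so no stub targets this cycle.

Nothing here refutes the crux; §1 says why it resists: it is summit-equivalent verbatim.
[Kontsevich–Zagier 2001, §1.2; Viu-Sos 2021, Thm 1.1; Cresson–Viu-Sos 2022, §1 p. 326, Problem 2.1]
-/

noncomputable section

set_option linter.dupNamespace false

open MeasureTheory Set MvPolynomial
open Literature.NumberTheory.Transcendental Literature.ModelTheory.ExponentialFields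

namespace Summit.KontsevichZagierPeriods.KontsevichZagierPeriods.Cruxes.VolumeFormOffPlane.Disproof

/-! ## Local mirrors of the three route decls (route-file-free publication)

This work file deliberately does NOT import `Theses/SymplecticScissors.lean`: that module was
farm-incoherent for the whole cycle (gate answer `remote:incoherent … Theses.SymplecticScissors:mismatch`,
2026-08-16T14:40Z–15:15Z), which blocks `ledger crux write` of any file importing it. The three
decls attacked are therefore MIRRORED verbatim below; each identification with the route decl is
`Iff.rfl` and is recorded in the disprover's `Negative/Link.lean` (checked, to be landed as soon as
the route module coheres). Everything landed under `Theorems/VolumeFormOffPlane/Negative/` is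
stated over the same verbatim bodies. -/

/-- LOCAL MIRROR (verbatim body) of the route decl `SymplecticScissors.VolumeFormOffPlane`,
stmt-KontsevichZagierPeriods-14935 — the crux under attack. -/
def VolumeFormOffPlane : Prop :=
  ∀ ⦃N : ℕ⦄, N ≠ 2 → ∀ (r r' : KZ.IntegralRep N), (∀ x ∈ r.domain, r.integrand x = 1) →
    (∀ x ∈ r'.domain, r'.integrand x = 1) → r.value = r'.value → KZ.Equivalent r r'

/-- LOCAL MIRROR (verbatim body) of the route decl `SymplecticScissors.VolumeForm`, stmt-3814 — the frame. -/
def VolumeForm : Prop :=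
  ∀ ⦃N : ℕ⦄ (r r' : KZ.IntegralRep N), (∀ x ∈ r.domain, r.integrand x = 1) →
    (∀ x ∈ r'.domain, r'.integrand x = 1) → r.value = r'.value → KZ.Equivalent r r'

/-- LOCAL MIRROR (verbatim body) of the route decl `SymplecticScissors.PlanarAreas`, stmt-4990 — the planar layer. -/
def PlanarAreas : Prop :=
  ∀ (r r' : KZ.IntegralRep 2), (∀ p ∈ r.domain, r.integrand p = 1) →
    (∀ p ∈ r'.domain, r'.integrand p = 1) → r.value = r'.value → KZ.Equivalent r r'

/-! ## §0 The crux sliced by dimension -/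

/-- The frame in ONE dimension `N`: two integrand-`1` representations of dimension `N` with equal
value are KZ-equivalent. [folklore] -/
def VolumeFormAt (N : ℕ) : Prop :=
  ∀ (r r' : KZ.IntegralRep N), (∀ x ∈ r.domain, r.integrand x = 1) →
    (∀ x ∈ r'.domain, r'.integrand x = 1) → r.value = r'.value → KZ.Equivalent r r'

/-- The crux is the frame off the plane, slice by slice (definitional). [folklore] -/
theorem volumeFormOffPlane_iff : VolumeFormOffPlane ↔ ∀ N, N ≠ 2 → VolumeFormAt N :=
  ⟨fun h _ hN r r' => h hN r r', fun h _ hN r r' => h _ hN r r'⟩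

/-- The frame is all slices (definitional). [folklore] -/
theorem volumeForm_iff : VolumeForm ↔ ∀ N, VolumeFormAt N :=
  ⟨fun h _ r r' => h r r', fun h _ r r' => h _ r r'⟩

/-- The planar layer is the slice `N = 2` (definitional). [folklore] -/
theorem planarAreas_iff : PlanarAreas ↔ VolumeFormAt 2 := Iff.rfl

/-! ## §1 Strength: the slab ladder; `N ≠ 2` is decorative; crux ↔ frame ↔ summit -/

/-- **SLAB LADDER.** The frame descends along dimensions: `VolumeFormAt (N+1) → VolumeFormAt N`.
Raise both representations by the unit slab `A ↦ A × [0,1]` (ONE Newton–Leibniz move each,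
`KZ.IntegralRep.equivalent_slab`, primitive `F (x,t) = t`); the slabs have integrand `1` and, by
soundness of the moves, equal values. [folklore] -/
theorem volumeFormAt_of_succ {N : ℕ} (h : VolumeFormAt (N + 1)) : VolumeFormAt N := by
  intro r r' hr hr' hv
  have e1 : r.value = (r.slab 0).value := KZ.Equivalent.value_eq_holds (r.equivalent_slab 0)
  have e2 : r'.value = (r'.slab 0).value := KZ.Equivalent.value_eq_holds (r'.equivalent_slab 0)
  have h1 := h (r.slab 0) (r'.slab 0) (r.slab_integrand_eq_one 0 hr)
    (r'.slab_integrand_eq_one 0 hr') (by rw [← e1, ← e2]; exact hv)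
  exact ((r.equivalent_slab 0).trans h1).trans (r'.equivalent_slab 0).symm

/-- The ladder iterated: `VolumeFormAt N → VolumeFormAt M` for `M ≤ N`. [folklore] -/
theorem volumeFormAt_of_le {M N : ℕ} (hMN : M ≤ N) (h : VolumeFormAt N) : VolumeFormAt M := by
  obtain ⟨d, rfl⟩ := Nat.exists_eq_add_of_le hMN
  induction d with
  | zero => simpa using h
  | succ d ih => exact ih (Nat.le_add_right M d) (volumeFormAt_of_succ h)

/-- Contrapositive ladder: the failing dimensions form an UP-SET — a counterexample in dimension
`M` propagates (by slabs) to every `N ≥ M`. [folklore] -/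
theorem not_volumeFormAt_of_le {M N : ℕ} (hMN : M ≤ N) (h : ¬ VolumeFormAt M) : ¬ VolumeFormAt N :=
  fun hN => h (volumeFormAt_of_le hMN hN)

/-- **`N ≠ 2` IS DECORATIVE.** The crux is equivalent to the frame restricted to `N ≥ 3`: the
slices `N = 0, 1, 2` all descend from the slice `N = 3` by the slab ladder. [folklore] -/
theorem volumeFormOffPlane_iff_forall_ge_three :
    VolumeFormOffPlane ↔ ∀ N, 3 ≤ N → VolumeFormAt N := by
  rw [volumeFormOffPlane_iff]
  refine ⟨fun h N hN => h N (by omega), fun h N hN => ?_⟩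
  rcases le_or_gt 3 N with h3 | h3
  · exact h N h3
  · exact volumeFormAt_of_le (show N ≤ 3 by omega) (h 3 le_rfl)

/-- **THE CRUX IS THE FRAME**: `VolumeFormOffPlane ↔ VolumeForm` (stmt-3814). The split
`FrameSplit : PlanarAreas → VolumeFormOffPlane → VolumeForm` therefore never needs its first
hypothesis: the plane is carried by dimension `3`. [folklore] -/
theorem volumeFormOffPlane_iff_volumeForm : VolumeFormOffPlane ↔ VolumeForm := by
  rw [volumeFormOffPlane_iff_forall_ge_three, volumeForm_iff]
  exact ⟨fun h N => (le_or_gt 3 N).elim (h N) fun h3 => volumeFormAt_of_le (by omega) (h 3 le_rfl),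
    fun h N _ => h N⟩

/-- **THE CRUX IS THE SUMMIT**: `VolumeFormOffPlane ↔ KontsevichZagierPeriods`.
`→`: the frame specialises to Cresson–Viu-Sos' compact volume conjecture, equivalent to
Conjecture 1 by the tree's discharge of Viu-Sos' semi-canonical reduction
(`KZ.kzPeriodConjecture'_iff_volumeConjectureCompact_holds`) and to the summit's literal-shape form
(`kzPeriodConjecture'_iff_isRational`). `←`: an integrand-`1` representation has KZ's literal
shape (`p = q = 1`). [Cresson–Viu-Sos 2022, §1 p. 326; Viu-Sos 2021, Thm 1.1] [folklore] -/
theorem volumeFormOffPlane_iff_summit : VolumeFormOffPlane ↔ KontsevichZagierPeriods := by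
  rw [volumeFormOffPlane_iff_volumeForm]
  constructor
  · intro hV
    have hvc : KZ.volumeConjectureCompact := fun _ r r' _ _ _ _ h1 h1' hv => hV r r' h1 h1' hv
    exact KontsevichZagierPeriods_iff.mpr (kzPeriodConjecture'_iff_isRational.mp
      (KZ.kzPeriodConjecture'_iff_volumeConjectureCompact_holds.mpr hvc))
  · intro hS N r r' hr hr' hv
    have hrat : ∀ s : KZ.IntegralRep N, (∀ x ∈ s.domain, s.integrand x = 1) → s.IsRational :=
      fun s hs => ⟨1, 1, fun x _ => by simp, fun x hx => by simp [hs x hx]⟩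
    exact KontsevichZagierPeriods_iff.mp hS r r' (hrat r hr) (hrat r' hr') hv

/-- Negative corollary (what this means for a disprover): a counterexample to the frame in ANY
single dimension — in particular a planar one (`N = 2`, the route's own layer) — refutes this
crux. [folklore] -/
theorem not_volumeFormOffPlane_of_not_volumeFormAt {N : ℕ} (h : ¬ VolumeFormAt N) :
    ¬ VolumeFormOffPlane := fun hO =>
  h ((volumeForm_iff.mp (volumeFormOffPlane_iff_volumeForm.mp hO)) N)

/-- In particular `¬ PlanarAreas → ¬ VolumeFormOffPlane`: the off-plane frame is not weaker than
the planar layer it was split from. [folklore] -/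
theorem not_volumeFormOffPlane_of_not_planarAreas (h : ¬ PlanarAreas) : ¬ VolumeFormOffPlane :=
  not_volumeFormOffPlane_of_not_volumeFormAt (N := 2) (planarAreas_iff.not.mp h)

/-- And `¬ KontsevichZagierPeriods → ¬ VolumeFormOffPlane`, `¬ VolumeFormOffPlane →
¬ KontsevichZagierPeriods`: killing the crux is killing the summit, verbatim. [folklore] -/
theorem not_volumeFormOffPlane_iff_not_summit : ¬ VolumeFormOffPlane ↔ ¬ KontsevichZagierPeriods :=
  volumeFormOffPlane_iff_summit.not

/-- Where a counterexample can live: `¬ VolumeFormOffPlane` iff the frame fails in some dimension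
`N ≥ 3`, iff it fails in ALL sufficiently large dimensions (up-set). [folklore] -/
theorem not_volumeFormOffPlane_iff_eventually_fails :
    ¬ VolumeFormOffPlane ↔ ∃ N₀, 3 ≤ N₀ ∧ ∀ N, N₀ ≤ N → ¬ VolumeFormAt N := by
  rw [volumeFormOffPlane_iff_forall_ge_three]
  push Not
  constructor
  · rintro ⟨N, hN, h⟩
    exact ⟨N, hN, fun M hM => not_volumeFormAt_of_le hM h⟩
  · rintro ⟨N₀, h3, h⟩
    exact ⟨N₀, h3, h N₀ le_rfl⟩


/-! ## §2 Load-bearing analysis of the three hypotheses -/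

/-! ### Kit: the point, the empty set, unit cubes -/

/-- The constant function `1` is ℚ-semialgebraic on every ℚ-semialgebraic set. [folklore] -/
theorem isSemialgebraicFunOn_one {N : ℕ} {s : Set (Fin N → ℝ)} (hs : IsSemialgebraic ℚ s) :
    IsSemialgebraicFunOn ℚ s (fun _ => (1 : ℝ)) :=
  (isSemialgebraicFunOn_natCast hs 1).congr fun _ _ => by simp

/-- Lebesgue measure on `ℝ⁰ = {pt}` is the Dirac mass. [folklore] -/
theorem volume_fin_zero : (volume : Measure (Fin 0 → ℝ)) = Measure.dirac default := by
  rw [MeasureTheory.volume_pi]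
  exact Measure.pi_of_empty _ _

/-- THE POINT: dimension `0`, domain `ℝ⁰ = {pt}`, integrand `1`, value `vol₀(pt) = 1`. [folklore] -/
def pointRep : KZ.IntegralRep 0 where
  domain := univ
  integrand := fun _ => 1
  isSemialgebraic_domain := isSemialgebraic_univ
  isSemialgebraicFunOn_integrand := isSemialgebraicFunOn_one isSemialgebraic_univ
  integrableOn := integrableOn_const (hs := by simp [volume_fin_zero])

/-- Unfolding. [folklore] -/
@[simp] theorem pointRep_domain : pointRep.domain = univ := rfl
/-- Unfolding. [folklore] -/
@[simp] theorem pointRep_integrand : pointRep.integrand = fun _ => 1 := rfl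

/-- The point has value `1`. [folklore] -/
theorem value_pointRep : pointRep.value = 1 := by
  simp [KZ.IntegralRep.value, volume_fin_zero, Measure.real]

/-- The empty representation has integrand `1` on its (empty) domain, vacuously. [folklore] -/
theorem empty_integrand_eq_one (N : ℕ) :
    ∀ x ∈ (KZ.IntegralRep.empty N).domain, (KZ.IntegralRep.empty N).integrand x = 1 := by
  simp

/-- THE CLOSED UNIT CUBE `[0,1]ᴺ` as the `N`-fold unit slab over the point (so it is reached from
the point by `N` Newton–Leibniz moves). [folklore] -/
def closedCube : (N : ℕ) → KZ.IntegralRep N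
  | 0 => pointRep
  | N + 1 => (closedCube N).slab 0

/-- The closed unit cube has integrand `1` on its domain. [folklore] -/
theorem closedCube_integrand_eq_one : ∀ N, ∀ x ∈ (closedCube N).domain, (closedCube N).integrand x = 1
  | 0 => fun _ _ => rfl
  | N + 1 => (closedCube N).slab_integrand_eq_one 0 (closedCube_integrand_eq_one N)

/-- The closed unit cube is KZ-equivalent to the point. [folklore] -/
theorem equivalent_pointRep_closedCube : ∀ N, KZ.Equivalent pointRep (closedCube N)
  | 0 => KZ.Equivalent.refl _
  | N + 1 => (equivalent_pointRep_closedCube N).trans ((closedCube N).equivalent_slab 0)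

/-- The closed unit cube has volume `1` (by soundness of the moves, from the point). [folklore] -/
theorem value_closedCube (N : ℕ) : (closedCube N).value = 1 := by
  rw [← KZ.Equivalent.value_eq_holds (equivalent_pointRep_closedCube N), value_pointRep]

/-- The closed unit cube is compact. [folklore] -/
theorem isCompact_closedCube_domain : ∀ N, IsCompact (closedCube N).domain
  | 0 => subsingleton_univ.isCompact
  | N + 1 => (closedCube N).isCompact_slabDomain 0 (isCompact_closedCube_domain N)

/-- Membership in the closed unit cube: all coordinates in `[0,1]`. [folklore] -/
theorem mem_closedCube_domain : ∀ (N : ℕ) (p : Fin N → ℝ),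
    p ∈ (closedCube N).domain ↔ ∀ i, 0 ≤ p i ∧ p i ≤ 1
  | 0, p => by simp [closedCube]
  | N + 1, p => by
    show p ∈ ((closedCube N).slab 0).domain ↔ _
    rw [KZ.IntegralRep.domain_slab, KZ.IntegralRep.slabDomain, mem_setOf_eq,
      mem_closedCube_domain N]
    simp only [Nat.cast_zero, zero_add, Fin.init]
    constructor
    · rintro ⟨h, h0, h1⟩ i
      refine Fin.lastCases ?_ (fun j => ?_) i
      · exact ⟨h0, h1⟩
      · exact h j
    · intro h
      exact ⟨fun j => h _, (h _).1, (h _).2⟩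

/-- Coordinate slabs `{lo < pᵢ < hi}` with rational ends are ℚ-semialgebraic. [folklore] -/
theorem isSemialgebraic_coord_Ioo {N : ℕ} (i : Fin N) (l u : ℚ) :
    IsSemialgebraic ℚ {p : Fin N → ℝ | p i ∈ Ioo (l : ℝ) u} := by
  have h := (isSemialgebraic_setOf_eval_lt (k := ℚ) (R := ℝ) (ι := Fin N) (C l) (X i)).inter
    (isSemialgebraic_setOf_eval_lt (k := ℚ) (R := ℝ) (ι := Fin N) (X i) (C u))
  have hEq : {p : Fin N → ℝ | p i ∈ Ioo (l : ℝ) u} =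
      {x : Fin N → ℝ | aeval x (C l : MvPolynomial (Fin N) ℚ) < aeval x (X i : MvPolynomial (Fin N) ℚ)} ∩
      {x : Fin N → ℝ | aeval x (X i : MvPolynomial (Fin N) ℚ) < aeval x (C u : MvPolynomial (Fin N) ℚ)} := by
    ext p; simp
  rw [hEq]; exact h

/-- The open unit cube `(0,1)ᴺ`. [folklore] -/
def openCubeSet (N : ℕ) : Set (Fin N → ℝ) := Set.pi univ fun _ => Ioo 0 1

/-- The open unit cube is the intersection of its coordinate slabs. [folklore] -/
theorem openCubeSet_eq_iInter (N : ℕ) :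
    openCubeSet N = ⋂ i ∈ (Finset.univ : Finset (Fin N)), {p : Fin N → ℝ | p i ∈ Ioo ((0:ℚ):ℝ) (1:ℚ)} := by
  ext p; simp [openCubeSet]

/-- The open unit cube is ℚ-semialgebraic. [folklore] -/
theorem isSemialgebraic_openCubeSet (N : ℕ) : IsSemialgebraic ℚ (openCubeSet N) := by
  rw [openCubeSet_eq_iInter]
  exact IsSemialgebraic.biInter _ _ fun i _ => isSemialgebraic_coord_Ioo i 0 1

/-- The open unit cube lies in the compact cube `Icc 0 1`. [folklore] -/
theorem openCubeSet_subset_Icc (N : ℕ) : openCubeSet N ⊆ Icc (0 : Fin N → ℝ) 1 := by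
  intro p hp
  simp only [openCubeSet, mem_pi, mem_univ, mem_Ioo, forall_const] at hp
  exact ⟨fun i => (hp i).1.le, fun i => (hp i).2.le⟩

/-- The open unit cube has finite volume. [folklore] -/
theorem volume_openCubeSet_ne_top (N : ℕ) : volume (openCubeSet N) ≠ ⊤ :=
  ((measure_mono (openCubeSet_subset_Icc N)).trans_lt isCompact_Icc.measure_lt_top).ne

/-- THE OPEN UNIT CUBE `(0,1)ᴺ` as an integrand-`1` representation. [folklore] -/
def openCube (N : ℕ) : KZ.IntegralRep N where
  domain := openCubeSet N
  integrand := fun _ => 1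
  isSemialgebraic_domain := isSemialgebraic_openCubeSet N
  isSemialgebraicFunOn_integrand := isSemialgebraicFunOn_one (isSemialgebraic_openCubeSet N)
  integrableOn := integrableOn_const (volume_openCubeSet_ne_top N)

/-- Unfolding. [folklore] -/
@[simp] theorem openCube_domain (N : ℕ) : (openCube N).domain = openCubeSet N := rfl
/-- Unfolding. [folklore] -/
@[simp] theorem openCube_integrand (N : ℕ) : (openCube N).integrand = fun _ => 1 := rfl

/-- The open unit cube has volume `1`. [folklore] -/
theorem value_openCube (N : ℕ) : (openCube N).value = 1 := by
  simp only [KZ.IntegralRep.value, openCube_domain, openCube_integrand, setIntegral_const, smul_eq_mul,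
    mul_one, Measure.real, openCubeSet]
  rw [Real.volume_pi_Ioo_toReal (fun _ => zero_le_one)]
  simp

/-- The open unit cube of positive dimension is not compact (coordinate `0` has no minimum on it). [folklore] -/
theorem not_isCompact_openCube_domain (N : ℕ) : ¬ IsCompact (openCube (N + 1)).domain := by
  intro hK
  have hne : (openCube (N + 1)).domain.Nonempty :=
    ⟨fun _ => 1/2, by simp only [openCube_domain, openCubeSet, mem_pi, mem_univ, mem_Ioo, forall_const]; norm_num⟩
  obtain ⟨p, hp, hmin⟩ := hK.exists_isMinOn hne (continuous_apply 0).continuousOn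
  simp only [openCube_domain, openCubeSet, mem_pi, mem_univ, mem_Ioo, forall_const] at hp
  set q : Fin (N + 1) → ℝ := Function.update p 0 (p 0 / 2) with hq_def
  have hq : q ∈ (openCube (N + 1)).domain := by
    simp only [openCube_domain, openCubeSet, mem_pi, mem_univ, mem_Ioo, forall_const, hq_def]
    intro i
    by_cases hi : i = 0
    · subst hi
      simp only [Function.update_self]
      exact ⟨by linarith [(hp 0).1], by linarith [(hp 0).2]⟩
    · rw [Function.update_of_ne hi]
      exact hp i
  have hle := (isMinOn_iff.mp hmin) q hq
  simp only [hq_def, Function.update_self] at hle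
  linarith [(hp 0).1]

/-- The closed and the open unit cube are different representations (the origin). [folklore] -/
theorem closedCube_ne_openCube (N : ℕ) : closedCube (N + 1) ≠ openCube (N + 1) := by
  intro h
  have h0 : (0 : Fin (N + 1) → ℝ) ∈ (closedCube (N + 1)).domain := by
    rw [mem_closedCube_domain]; intro i; simp
  rw [h] at h0
  simp [openCube_domain, openCubeSet, mem_pi] at h0

/-! ### (a) `value_eq` is load-bearing -/

/-- The crux with the hypothesis `r.value = r'.value` DROPPED (stated only to be negated). -/
def VolumeFormOffPlaneWithoutValueEq : Prop :=
  ∀ ⦃N : ℕ⦄, N ≠ 2 → ∀ (r r' : KZ.IntegralRep N), (∀ x ∈ r.domain, r.integrand x = 1) →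
    (∀ x ∈ r'.domain, r'.integrand x = 1) → KZ.Equivalent r r'

/-- **ANY PROOF MUST USE `value_eq`** — witness in dimension `0`: the point (value `1`) and the
empty set (value `0`) are integrand-`1` representations that are not KZ-equivalent, by soundness
of the moves (`KZ.Equivalent.value_eq_holds`). [folklore] -/
theorem volumeFormOffPlane_false_without_valueEq : ¬ VolumeFormOffPlaneWithoutValueEq := by
  intro h
  have hE := h (N := 0) (by decide) pointRep (KZ.IntegralRep.empty 0) (fun _ _ => rfl)
    (empty_integrand_eq_one 0)
  have hv := KZ.Equivalent.value_eq_holds hE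
  rw [value_pointRep, KZ.IntegralRep.value_empty] at hv
  exact one_ne_zero hv

/-- The same in the crux's open range, dimension `3`: the closed unit cube `[0,1]³` (value `1`) and
the empty solid (value `0`). So `value_eq` is load-bearing in every slice, not only in the
degenerate one. [folklore] -/
theorem volumeFormOffPlane_false_without_valueEq_dim_three :
    ¬ (∀ (r r' : KZ.IntegralRep 3), (∀ x ∈ r.domain, r.integrand x = 1) →
        (∀ x ∈ r'.domain, r'.integrand x = 1) → KZ.Equivalent r r') := by
  intro h
  have hE := h (closedCube 3) (KZ.IntegralRep.empty 3) (closedCube_integrand_eq_one 3)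
    (empty_integrand_eq_one 3)
  have hv := KZ.Equivalent.value_eq_holds hE
  rw [value_closedCube, KZ.IntegralRep.value_empty] at hv
  exact one_ne_zero hv

/-! ### (b) `integrand = 1` is NOT load-bearing: dropping it gives the summit again -/

/-- The crux with BOTH integrand hypotheses dropped: Conjecture 1 for same-dimension pairs of
arbitrary representations, off the plane. -/
def VolumeFormOffPlaneWithoutIntegrandOne : Prop :=
  ∀ ⦃N : ℕ⦄, N ≠ 2 → ∀ (r r' : KZ.IntegralRep N), r.value = r'.value → KZ.Equivalent r r'

/-- **`integrand = 1` IS A NORMALISATION, NOT A HYPOTHESIS**: the crux without it is again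
equivalent to the summit (`→` through the crux itself and §1; `←` because the summit is
Conjecture 1 for all pairs, `kzPeriodConjecture'_iff_isRational`). So no `_false_without_integrandOne`
lemma can exist short of `¬ KontsevichZagierPeriods`. [Viu-Sos 2021, Thm 1.1] [folklore] -/
theorem withoutIntegrandOne_iff_summit : VolumeFormOffPlaneWithoutIntegrandOne ↔ KontsevichZagierPeriods := by
  constructor
  · intro h
    exact volumeFormOffPlane_iff_summit.mp fun N hN r r' _ _ hv => h hN r r' hv
  · intro hS N _ r r' hv
    exact (kzPeriodConjecture'_iff_isRational.mpr (KontsevichZagierPeriods_iff.mp hS)) r r' hv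

/-- Hence the two forms of the crux are equivalent to each other. [folklore] -/
theorem withoutIntegrandOne_iff : VolumeFormOffPlaneWithoutIntegrandOne ↔ VolumeFormOffPlane :=
  withoutIntegrandOne_iff_summit.trans volumeFormOffPlane_iff_summit.symm

/-! ### (c) `N ≠ 2` is NOT load-bearing: dropping it gives the frame, equivalent again (§1) -/

/-- The crux with `N ≠ 2` dropped is verbatim the frame `VolumeForm` (stmt-3814), and
`volumeFormOffPlane_iff_volumeForm` says the two are equivalent. [folklore] -/
theorem withoutDimRestriction_iff : VolumeForm ↔ VolumeFormOffPlane := volumeFormOffPlane_iff_volumeForm.symm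

/-! ## §3 Degenerate instances hold: junk immunity of the encoding -/

/-- NULL DOMAINS ARE ZERO: if `vol(σ) = 0` then `[s] ∈ relations` (rule 1a for `σ = σ ∪ σ` with
null overlap reads `[s] − [s] − [s] ∈ relations`). No integrand hypothesis is needed. [folklore] -/
theorem of_mem_relations_of_volume_eq_zero {N : ℕ} (s : KZ.IntegralRep N) (h0 : volume s.domain = 0) :
    KZ.of s ∈ KZ.relations := by
  have h1a : KZ.of s - KZ.of s - KZ.of s ∈ KZ.domainAddRel :=
    ⟨N, s, s, s, (union_self _).symm, by simpa using h0, fun _ _ => rfl, fun _ _ => rfl, rfl⟩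
  have hneg := KZ.relations.neg_mem (KZ.domainAddRel_subset_relations h1a)
  simpa using hneg

/-- OFF-DOMAIN VALUES ARE INVISIBLE: two integrand-`1` representations with the same domain are
equivalent by ONE identity change of variables (`Φ = id`, `|det| = 1`). [folklore] -/
theorem equivalent_of_domain_eq {N : ℕ} (r r' : KZ.IntegralRep N)
    (hr : ∀ x ∈ r.domain, r.integrand x = 1) (hr' : ∀ x ∈ r'.domain, r'.integrand x = 1)
    (h : r.domain = r'.domain) : KZ.Equivalent r r' := by
  refine KZ.changeOfVariablesRel_subset_relations ?_
  refine ⟨N, r, r', id, fun _ => ContinuousLinearMap.id ℝ (Fin N → ℝ),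
    isSemialgebraicMapOn_id r.isSemialgebraic_domain, fun x _ => hasFDerivWithinAt_id x _,
    injOn_id _, by simp [h], fun x hx => ?_, rfl⟩
  simp [hr x hx, hr' x (h ▸ hx), ContinuousLinearMap.det]

/-- The value of an integrand-`1` representation is the (real) volume of its domain. [folklore] -/
theorem value_eq_volumeReal {N : ℕ} (r : KZ.IntegralRep N) (hr : ∀ x ∈ r.domain, r.integrand x = 1) :
    r.value = volume.real r.domain := by
  rw [KZ.IntegralRep.value, setIntegral_congr_fun (KZ.IntegralRep.measurableSet_domain_holds r)
    (fun x hx => hr x hx), setIntegral_const, smul_eq_mul, mul_one]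

/-- An integrand-`1` representation has a domain of finite volume. [folklore] -/
theorem volume_domain_lt_top {N : ℕ} (r : KZ.IntegralRep N) (hr : ∀ x ∈ r.domain, r.integrand x = 1) :
    volume r.domain < ⊤ := by
  have hint : IntegrableOn (fun _ => (1 : ℝ)) r.domain :=
    r.integrableOn.congr_fun (fun x hx => hr x hx) (KZ.IntegralRep.measurableSet_domain_holds r)
  have := (integrableOn_const_iff).mp hint
  simpa using this

/-- VALUE ZERO MEANS NULL: an integrand-`1` representation of value `0` has a null domain, hence is
`0` modulo moves. [folklore] -/
theorem of_mem_relations_of_value_eq_zero {N : ℕ} (r : KZ.IntegralRep N)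
    (hr : ∀ x ∈ r.domain, r.integrand x = 1) (hv : r.value = 0) : KZ.of r ∈ KZ.relations := by
  apply of_mem_relations_of_volume_eq_zero
  rw [value_eq_volumeReal r hr, measureReal_def, ENNReal.toReal_eq_zero_iff] at hv
  exact hv.resolve_right (volume_domain_lt_top r hr).ne

/-- The value-`0` instances of the crux hold in EVERY dimension (both sides are `0` modulo moves). [folklore] -/
theorem equivalent_of_value_eq_zero {N : ℕ} (r r' : KZ.IntegralRep N)
    (hr : ∀ x ∈ r.domain, r.integrand x = 1) (hr' : ∀ x ∈ r'.domain, r'.integrand x = 1)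
    (hv : r.value = 0) (hv' : r'.value = 0) : KZ.Equivalent r r' :=
  KZ.relations.sub_mem (of_mem_relations_of_value_eq_zero r hr hv)
    (of_mem_relations_of_value_eq_zero r' hr' hv')

/-- **THE SLICE `N = 0` IS A THEOREM** (the lead's `stub_dimZero`): a domain in `ℝ⁰ = {pt}` is `∅`
or `{pt}`; equal values exclude the mixed case (`0 ≠ 1`), two points are one identity move apart,
two empty sets are both `0` modulo moves. [folklore] -/
theorem volumeFormAt_zero : VolumeFormAt 0 := by
  intro r r' hr hr' hv
  have hcase : ∀ s : Set (Fin 0 → ℝ), s = ∅ ∨ s = univ := fun s =>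
    s.eq_empty_or_nonempty.imp id fun h => Subsingleton.eq_univ_of_nonempty h
  have hval : ∀ s : KZ.IntegralRep 0, (∀ x ∈ s.domain, s.integrand x = 1) →
      (s.domain = ∅ → s.value = 0) ∧ (s.domain = univ → s.value = 1) := fun s hs =>
    ⟨fun h => by rw [value_eq_volumeReal s hs, h]; simp,
     fun h => by rw [value_eq_volumeReal s hs, h]; simp [volume_fin_zero, Measure.real]⟩
  rcases hcase r.domain with h1 | h1 <;> rcases hcase r'.domain with h2 | h2
  · exact equivalent_of_value_eq_zero r r' hr hr' ((hval r hr).1 h1) ((hval r' hr').1 h2)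
  · exact absurd (((hval r hr).1 h1).symm.trans (hv.trans ((hval r' hr').2 h2))) zero_ne_one
  · exact absurd (((hval r' hr').1 h2).symm.trans (hv.symm.trans ((hval r hr).2 h1))) zero_ne_one
  · exact equivalent_of_domain_eq r r' hr hr' (h1.trans h2.symm)

/-! ## §4 Refuted natural strengthening: ONE move never suffices -/

/-- NATURAL STRENGTHENING (stated only to be negated): equal-volume integrand-`1` representations
off the plane differ by a SINGLE instance of one of the four rules. -/
def VolumeFormOffPlaneOneMove : Prop :=
  ∀ ⦃N : ℕ⦄, N ≠ 2 → ∀ (r r' : KZ.IntegralRep N), (∀ x ∈ r.domain, r.integrand x = 1) →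
    (∀ x ∈ r'.domain, r'.integrand x = 1) → r.value = r'.value →
    KZ.of r - KZ.of r' ∈ KZ.domainAddRel ∪ KZ.integrandAddRel ∪ KZ.changeOfVariablesRel ∪ KZ.newtonLeibnizRel

/-- FREE-GROUP PINNING: in a free abelian group, `of a − of b = of c − of d` with `a ≠ b` forces
`a = c` and `b = d` (evaluate the counting homomorphisms at `a` and at `b`). [folklore] -/
theorem eq_of_of_sub_of_eq {X : Type*} {a b c d : X} (hab : a ≠ b)
    (h : FreeAbelianGroup.of a - FreeAbelianGroup.of b =
      FreeAbelianGroup.of c - FreeAbelianGroup.of d) : a = c ∧ b = d := by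
  classical
  have key : ∀ x : X, ((if a = x then (1:ℤ) else 0) - (if b = x then 1 else 0)) =
      ((if c = x then 1 else 0) - (if d = x then 1 else 0)) := fun x => by
    simpa only [map_sub, FreeAbelianGroup.lift_apply_of] using
      congrArg (FreeAbelianGroup.lift fun y => if y = x then (1:ℤ) else 0) h
  have ha := key a
  have hb := key b
  rw [if_pos rfl, if_neg (Ne.symm hab)] at ha
  rw [if_pos rfl, if_neg hab] at hb
  refine ⟨?_, ?_⟩
  · by_contra hca
    rw [if_neg (show ¬ c = a from fun h => hca h.symm)] at ha
    by_cases hda : d = a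
    · rw [if_pos hda] at ha; omega
    · rw [if_neg hda] at ha; omega
  · by_contra hdb
    rw [if_neg (show ¬ d = b from fun h => hdb h.symm)] at hb
    by_cases hcb : c = b
    · rw [if_pos hcb] at hb; omega
    · rw [if_neg hcb] at hb; omega

/-- AUGMENTATION: a difference of two generators is never a three-term move instance
`of s − of s₁ − of s₂` (rules 1a, 1b): count generators with sign. [folklore] -/
theorem of_sub_of_ne_three_term {X : Type*} (a b c d e : X) :
    FreeAbelianGroup.of a - FreeAbelianGroup.of b ≠
      FreeAbelianGroup.of c - FreeAbelianGroup.of d - FreeAbelianGroup.of e := by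
  intro h
  have := congrArg (FreeAbelianGroup.lift fun _ : X => (1:ℤ)) h
  simp only [map_sub, FreeAbelianGroup.lift_apply_of] at this
  omega

/-- **ONE MOVE NEVER SUFFICES** (rule 1a is load-bearing; the chain form is forced): in
dimension `3`, `[0,1]³` and `(0,1)³` have volume `1` each but `[[0,1]³] − [(0,1)³]` is no single
instance of any rule — not 1a/1b (augmentation), not Newton–Leibniz (it relates two different
dimensions, the free group pins the pair), not a change of variables (its map is differentiable
within the compact closed cube at every point, hence continuous there, so the image is compact —
but the open cube is not). The same pair in dimension `1` (`[0,1]` vs `(0,1)`) gives the slice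
`N = 1`. [folklore] -/
theorem not_volumeFormOffPlaneOneMove : ¬ VolumeFormOffPlaneOneMove := by
  intro h
  have hmem := h (N := 3) (by decide) (closedCube 3) (openCube 3) (closedCube_integrand_eq_one 3)
    (fun _ _ => rfl) (by rw [value_closedCube, value_openCube])
  have hne : (⟨3, closedCube 3⟩ : Σ n, KZ.IntegralRep n) ≠ ⟨3, openCube 3⟩ := fun h' =>
    closedCube_ne_openCube 2 (by
      rw [Sigma.mk.inj_iff] at h'
      exact eq_of_heq h'.2)
  rcases hmem with ((h1a | h1b) | h2) | h3
  · obtain ⟨n, s, s₁, s₂, -, -, -, -, hEq⟩ := h1a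
    exact of_sub_of_ne_three_term _ _ _ _ _ hEq
  · obtain ⟨n, s, s₁, s₂, -, -, -, hEq⟩ := h1b
    exact of_sub_of_ne_three_term _ _ _ _ _ hEq
  · obtain ⟨n, r₀, r₀', Φ, Φ', -, hder, -, hdom, -, hEq⟩ := h2
    obtain ⟨e1, e2⟩ := eq_of_of_sub_of_eq hne hEq
    rw [Sigma.mk.inj_iff] at e1 e2
    obtain ⟨rfl, e1⟩ := e1
    obtain ⟨-, e2⟩ := e2
    have e1' : closedCube 3 = r₀ := eq_of_heq e1
    have e2' : openCube 3 = r₀' := eq_of_heq e2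
    subst e1' e2'
    have hcont : ContinuousOn Φ (closedCube 3).domain := fun x hx => (hder x hx).continuousWithinAt
    have hK : IsCompact (openCube 3).domain := by
      rw [hdom]; exact (isCompact_closedCube_domain 3).image_of_continuousOn hcont
    exact not_isCompact_openCube_domain 2 hK
  · obtain ⟨n, s, s', -, -, -, -, -, -, -, -, -, -, -, hEq⟩ := h3
    obtain ⟨e1, e2⟩ := eq_of_of_sub_of_eq hne hEq
    rw [Sigma.mk.inj_iff] at e1 e2
    omega

/-! ## §4b The natural WEAKENING "up to torsion" is not weaker -/

section Torsion
open Literature.NumberTheory.Transcendental.KZ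

/-- Every formal combination `c` is congruent to `k • scale (1/k) c` modulo relations (generatorwise:
`[σ, f] − [σ, k·(f/k)]` is congruence, `[σ, k·(f/k)] − k•[σ, f/k]` is integrand additivity).
Re-derived here from Literature (`KZ.scale`, `KZ.IntegralRep.of_constMul_nat_sub_nsmul_mem_relations`,
`KZ.of_sub_of_mem_relations_of_eqOn`) because the tree's copy
(`MultiplicationAccessible.Negative.sub_nsmul_scale_inv_mem_relations`) sits behind a route file. [folklore] -/
theorem sub_nsmul_scale_inv_mem_relations {k : ℕ} (hk : k ≠ 0) (c : FormalRep) :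
    c - k • scale ((k : ℝ)⁻¹) (IsAlgebraic.inv_iff.mpr (isAlgebraic_nat k)) c ∈ relations := by
  have hk' : (k : ℝ) ≠ 0 := Nat.cast_ne_zero.mpr hk
  have hgen : ∀ {n : ℕ} (r : IntegralRep n),
      of r - k • scale ((k : ℝ)⁻¹) (IsAlgebraic.inv_iff.mpr (isAlgebraic_nat k)) (of r) ∈ relations := by
    intro n r
    rw [scale_of]
    set r₁ := r.constMul ((k : ℝ)⁻¹) (IsAlgebraic.inv_iff.mpr (isAlgebraic_nat k)) with hr₁
    have h1 : of (r₁.constMul (k : ℝ) (isAlgebraic_nat k)) - k • of r₁ ∈ relations :=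
      IntegralRep.of_constMul_nat_sub_nsmul_mem_relations r₁ k
    have h2 : of r - of (r₁.constMul (k : ℝ) (isAlgebraic_nat k)) ∈ relations := by
      refine of_sub_of_mem_relations_of_eqOn rfl fun x _ => ?_
      simp only [hr₁, IntegralRep.integrand_constMul]
      rw [← mul_assoc, mul_inv_cancel₀ hk', one_mul]
    have : of r - k • of r₁ = (of r - of (r₁.constMul (k : ℝ) (isAlgebraic_nat k))) +
        (of (r₁.constMul (k : ℝ) (isAlgebraic_nat k)) - k • of r₁) := by abel
    rw [this]
    exact relations.add_mem h2 h1
  induction c using FreeAbelianGroup.induction_on with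
  | zero => simp
  | of x => obtain ⟨n, r⟩ := x; exact hgen r
  | neg x hx =>
    obtain ⟨n, r⟩ := x
    have h := relations.neg_mem (hgen r)
    have : -of r - k • scale ((k : ℝ)⁻¹) (IsAlgebraic.inv_iff.mpr (isAlgebraic_nat k)) (-of r) =
        -(of r - k • scale ((k : ℝ)⁻¹) (IsAlgebraic.inv_iff.mpr (isAlgebraic_nat k)) (of r)) := by
      rw [map_neg, smul_neg]; abel
    exact this ▸ h
  | add x y hx hy =>
    have : x + y - k • scale ((k : ℝ)⁻¹) (IsAlgebraic.inv_iff.mpr (isAlgebraic_nat k)) (x + y) =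
        (x - k • scale ((k : ℝ)⁻¹) (IsAlgebraic.inv_iff.mpr (isAlgebraic_nat k)) x) +
        (y - k • scale ((k : ℝ)⁻¹) (IsAlgebraic.inv_iff.mpr (isAlgebraic_nat k)) y) := by
      rw [map_add, smul_add]; abel
    rw [this]
    exact relations.add_mem hx hy

/-- **`FormalRep ⧸ relations` IS TORSION-FREE** (tree: `MultiplicationAccessible.Negative.mem_relations_of_nsmul_mem_relations`;
re-derived route-file-free): `k • c ∈ relations`, `k ≠ 0` ⇒ `c ∈ relations`. [folklore] -/
theorem mem_relations_of_nsmul_mem_relations {k : ℕ} (hk : k ≠ 0) {c : FormalRep}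
    (h : k • c ∈ relations) : c ∈ relations := by
  have h1 := sub_nsmul_scale_inv_mem_relations hk c
  have h2 : k • scale ((k : ℝ)⁻¹) (IsAlgebraic.inv_iff.mpr (isAlgebraic_nat k)) c ∈ relations := by
    rw [← map_nsmul]
    exact scale_mem_relations _ _ h
  simpa using relations.add_mem h1 h2

end Torsion

/-- The crux UP TO TORSION: some non-zero multiple of `[r] − [r']` is a relation. -/
def VolumeFormOffPlaneUpToTorsion : Prop :=
  ∀ ⦃N : ℕ⦄, N ≠ 2 → ∀ (r r' : KZ.IntegralRep N), (∀ x ∈ r.domain, r.integrand x = 1) →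
    (∀ x ∈ r'.domain, r'.integrand x = 1) → r.value = r'.value →
    ∃ k : ℕ, k ≠ 0 ∧ k • (KZ.of r - KZ.of r') ∈ KZ.relations

/-- **"Only `k·([r] − [r'])` is derivable" cannot happen**: the up-to-torsion weakening is
equivalent to the crux, because `FormalRep ⧸ relations` is torsion-free. So the ℤ-linearity of the
formalised Conjecture 1 ("no division by integers is a rule") offers no refutation of this crux. [folklore] -/
theorem volumeFormOffPlane_iff_upToTorsion : VolumeFormOffPlane ↔ VolumeFormOffPlaneUpToTorsion := by
  refine ⟨fun h N hN r r' hr hr' hv => ⟨1, one_ne_zero, ?_⟩, fun h N hN r r' hr hr' hv => ?_⟩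
  · rw [one_nsmul]; exact h hN r r' hr hr' hv
  · obtain ⟨k, hk, hmem⟩ := h hN r r' hr hr' hv
    exact mem_relations_of_nsmul_mem_relations hk hmem

/-! ## §5 The Dehn form: the only shape a refutation can take -/

/-- **DEHN FORM OF `¬ VolumeFormOffPlane`.** The crux fails iff there is an additive invariant of
formal ℤ-combinations of representations, vanishing on every instance of the four rules, that
separates two equal-volume integrand-`1` representations of some dimension `N ≥ 3` — a
"generalised Dehn invariant of ℚ-semialgebraic solids finer than volume". (`→`: the quotient map
by `KZ.relations`, with §1 to push the failure to `N ≥ 3`; `←`: kernels are subgroups.) No point-set,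
junk, torsion or one-move phenomenon (§§3–4) is such an invariant. [folklore] -/
theorem not_volumeFormOffPlane_iff_exists_invariant :
    ¬ VolumeFormOffPlane ↔ ∃ (A : Type) (_ : AddCommGroup A) (D : KZ.FormalRep →+ A),
      (∀ c ∈ KZ.domainAddRel ∪ KZ.integrandAddRel ∪ KZ.changeOfVariablesRel ∪ KZ.newtonLeibnizRel,
        D c = 0) ∧
      ∃ N, 3 ≤ N ∧ ∃ r r' : KZ.IntegralRep N, (∀ x ∈ r.domain, r.integrand x = 1) ∧
        (∀ x ∈ r'.domain, r'.integrand x = 1) ∧ r.value = r'.value ∧ D (KZ.of r) ≠ D (KZ.of r') := by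
  constructor
  · intro hO
    have h' : ¬ ∀ N, 3 ≤ N → VolumeFormAt N := fun h => hO (volumeFormOffPlane_iff_forall_ge_three.mpr h)
    simp only [VolumeFormAt] at h'
    push Not at h'
    obtain ⟨N, hN, r, r', hr, hr', hv, hne⟩ := h'
    refine ⟨KZ.FormalRep ⧸ KZ.relations, inferInstance, QuotientAddGroup.mk' KZ.relations,
      fun c hc => ?_, N, hN, r, r', hr, hr', hv, fun hD => hne ?_⟩
    · rw [QuotientAddGroup.mk'_apply, QuotientAddGroup.eq_zero_iff]
      exact AddSubgroup.subset_closure hc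
    · rw [← sub_eq_zero, ← map_sub, QuotientAddGroup.mk'_apply, QuotientAddGroup.eq_zero_iff] at hD
      exact hD
  · rintro ⟨A, _, D, hD, N, hN, r, r', hr, hr', hv, hne⟩ hO
    have hmem : KZ.of r - KZ.of r' ∈ KZ.relations := hO (by omega) r r' hr hr' hv
    have hle : KZ.relations ≤ D.ker := (AddSubgroup.closure_le _).mpr fun c hc => hD c hc
    have h0 := hle hmem
    rw [AddMonoidHom.mem_ker, map_sub, sub_eq_zero] at h0
    exact hne h0

/-! ## §6 Targets / line notes

-- Targets: none this cycle (payload.targets = [], stuck_stubs = []; no skeleton registered yet —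
-- `ledger crux ls` shows Ideas/, BarrierNotes, Numerics, PICKED.md only).
-- Line picked by the lead (PICKED.md): `log-polytope-hilbert-three` (toric sector: formal volume in
-- Symⁿ_ℚ(Λ), rank-2 unconditional via Gelfond–Schneider), announced stubs `stub_dimZero` (= §3
-- `volumeFormAt_zero` here, PROVED), `stub_dimOne` (finite unions of intervals; true — needs the
-- structure theorem for ℚ-semialgebraic subsets of the line; §3 supplies the null / same-domain /
-- value-0 bookkeeping, §4 says cuts are needed even there), `stub_rankTwoToricBoxes` (positive sector
-- theorem, not attackable by small models: its arithmetic half is a theorem), `stub_frameHighResidual`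
-- (declared summit-strength; by §1 any statement implying `∀ N ≥ 3, VolumeFormAt N` IS the summit).
-- When the skeleton is registered the stubs become `-- Targets` here.
-/

/-! ## §7 Why it resists — candidate invariants examined (cycle 1), and why each dies

By §5 a kill is an additive `D : FormalRep →+ A` vanishing on the four move sets and finer than
volume on solids of some dimension `N ≥ 3`; by §1 it is then a disproof of the summit as formalised.
Candidates examined on paper this cycle (none survives; recorded so nobody re-runs them):

1. o-minimal EULER CHARACTERISTIC `χ(σ)` (and every valuation-type / combinatorial invariant of the
   domain: number of top cells, components of the regular locus, boundary strata): additive only on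
   DISJOINT unions, while rule 1a allows null overlaps — `σ = σ ∪ σ` for null `σ` gives `[σ] ≡ 0`
   (§3 `of_mem_relations_of_volume_eq_zero`) although `χ(pt) = 1`; and a ball is cut into two
   half-balls. Dies on rule 1a alone. (For the 1-dimensional SUB-calculus without 1a it survives:
   `Theorems/RealOnePeriodRelations/Negative/IntervalEuler*` — irrelevant here, 1a is in the crux.)
2. OFF-DOMAIN / POINT-SET JUNK (integrand values off the domain, isolated points, the empty set,
   dimension `0`): invisible — §3 (`equivalent_of_domain_eq`, null sets, `volumeFormAt_zero`).
3. EXOTIC INTEGRATION FUNCTIONALS (another "∫" satisfying 1a, 1b, the real Jacobian rule and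
   fibrewise FTC): rule 2 with `|det Φ'|` for all semialgebraic `C¹` injections pins a
   translation-invariant, linearly-covariant Radon functional, i.e. `c_N ·` Lebesgue in each
   dimension; rule 3 forces `c_{N+1} = c_N`, rule 1b in dimension 0 forces linearity: same kernel as
   `eval`. p-adic / motivic (Euler) integration violate the archimedean `|det|`. Dies.
4. GALOIS / REAL-CLOSED TRANSFER (conjugating the real-algebraic parameters, or reading the
   ℚ-formulas in another real closed field): a FIXED ℚ-definable set has no parameters to move, and
   conjugation `√2 ↦ −√2` is not induced by any map of ℝ; any invariant read off the defining
   formula is already a function of the set. Gives nothing beyond (3). (Contrast BarrierNotes N2: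
   with REAL transcendental parameters the frame is false by a germ argument — but the crux has
   coefficients in ℚ.)
5. TORSION (the ℤ-linear reading "no division by integers is a rule", Statement.lean): could
   `n([A] − [B]) ∈ relations` hold with `[A] − [B] ∉ relations`? No — `FormalRep ⧸ relations` is
   TORSION-FREE, kernel-checked in the tree (`MultiplicationAccessible.Negative.mem_relations_of_nsmul_mem_relations`,
   from the integrand-scaling endomorphism `KZ.scale (1/k)` of `KZRelationsLE.lean`), and the
   up-to-torsion weakening of THIS crux is equivalent to it (§4b `volumeFormOffPlane_iff_upToTorsion`,
   with the torsion-freeness re-derived route-file-free from `KZ.scale`). So the ℤ-vs-ℚ̄ reading is not a failure mode. (An independent route to the same fact: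
   the halve-coordinate-0 endomorphism also preserves all four move sets.)
6. CALCULUS WEAKER THAN MOTIVES (the one scenario in which the crux could be false WITHOUT
   contradicting Grothendieck–Kontsevich): two solids with equal FORMAL (Nori) period that the four
   rules as fixed in `KZCalculus.lean` cannot connect. Ayoub's reformulation (Stokes along coordinate
   directions + dummy variables on `O_alg(D̄ⁿ)`-integrands over the unit cube generate all relations,
   equivalently to the Grothendieck–Kontsevich conjecture) suggests the fixed rules are strong enough
   once every representation is moved into Ayoub's shape — which needs desingularisation of boundary
   singularities of cell Jacobians (route AyoubSpecialisation's business; Viu-Sos' reduction in the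
   tree avoids resolution but lands on indicator integrands, not on Ayoub's holomorphic ones). No
   concrete candidate pair is known; every explicit equal-volume pair tried in the frame chain
   (Cruxes/VolumeForm: cubes/boxes, balls vs cylinders via Archimedes, log-boxes at rank ≤ 2, KZ's
   π-family) is connected by explicit moves.
7. STRENGTH BARRIERS: by `volumeFormOffPlane_iff_summit` every catalogued strength barrier of the
   summit (`Literature.Barriers.KontsevichZagierPeriods.GrothendieckPeriodConjectureDependence*`:
   KZ ⇒ algebraic independence of `2πi, log α` / of elliptic periods / of odd zeta values, each
   modulo its motivic-invariant hypothesis) applies to this crux VERBATIM: a proof of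
   `VolumeFormOffPlane` is a proof of the summit. Conversely no barrier yields a disproof.

VERDICT (cycle 1): no kill; the crux resists because it is, verbatim up to the slab ladder, the
Kontsevich–Zagier conjecture as formalised. LANDED through the gate (route-file-free, because the
route module was farm-incoherent all afternoon): `Theorems/VolumeFormOffPlane/Negative/Core.lean`
(p110650: §§1–3, §5 over the slice — ladder, crux ↔ frame ↔ Conjecture 1 ↔ summit, value_eq
load-bearing in dims 0 and 3, integrand = 1 not load-bearing, junk immunity, slice N = 0 proved,
Dehn form) and `…/Negative/OneMove.lean` (p110702: §4). The one-line transcriptions to the route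
decl (`Negative/Link.lean`, in the disprover's folder, checked) wait for the route module to cohere.
-/

end Summit.KontsevichZagierPeriods.KontsevichZagierPeriods.Cruxes.VolumeFormOffPlane.Disproof
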